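import Summits.BirchSwinnertonDyer.Rank1Residual.O5.HeegnerLogTransportThreeStepZeroEndAnyDiscr
import Summits.BirchSwinnertonDyer.Rank1Residual.O5.HeegnerLogTransportThreeIsoCurrency
import Summits.BirchSwinnertonDyer.Rank1Residual.O5.NoLocalThreeTorsionIIIstar
import HarnessLib
import HarnessLib.Audit.Tags

/-!
# O5 `HeegnerLogTransportThree` — the step-0 END with `ht3` DISCHARGED on the `III*` stratum:
# `o5_index_unit_of_ordinary_companion_cited_s0g` (+ the ISO / X3E currencies) — part 23
# (cell `b2b-bsdres`, lane CLASS-CLOSURE, class O5; seat o5-r2 = O5 PLANNER 2, GEN 25)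

HONEST FRAMING (cell `b2b-bsdres`, run/shared/lean/b2b/bsd-rank1-residual/, verbatim in every
file): the goal of the cell is to DELETE the COMBINATION-SHAPED residual classes of the
Birch–Swinnerton-Dyer formula for ALL analytic-rank `≤ 1` elliptic curves over `ℚ` — "full BSD
formula for every rank `≤ 1` curve in class `C`" assembled STRICTLY from published theorems — so
that the rank-`≤ 1` remainder becomes exactly the CONSTRUCTION-SHAPED classes, which are TYPED
(missing-input `Prop`s), NOT attempted. This is not "finishing BSD". Lane CLASS-CLOSURE: research
routes; every END below is a CONDITIONAL theorem (its cited inputs are displayed as hypotheses: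
`hKL` Kriz–Li 2019 Thm 1.16, `hYZ` Yan–Zhu 2026 Thm 4.15, `hW20` Wuthrich 2014 Lemma 20, `hPT`/`hEP`
Poitou–Tate / local Euler–Poincaré, `hmod` modularity, `hGZK` Gross–Zagier–Kolyvagin); nothing is
booked; no mark / label / count / tier of `RESIDUAL-MAP.md` moves; census numbers are EVIDENCE;
THEOREMS ONLY (no definition, no named fact, no conjecture node; net named-fact debt `0`); no node
file is touched; O5 stays OPEN.

## What this file does

The END of record `o5_index_unit_of_ordinary_companion_cited_s0f`
(`O5/HeegnerLogTransportThreeStepZeroEndAnyDiscr.lean`, harvest-2 p356092: `3 ∤ [W(K) : ℤ·P_K]` for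
the Heegner point of an O5b curve `W` with a good-ORDINARY mod-3 congruent companion `G`, every
cited input displayed) carries the local binder `ht3 : NoLocalThreeTorsionAt W 3` (`W(ℚ₃)[3] = 0`).
`O5/NoLocalThreeTorsionIIIstar.lean` (o5-r2 GEN 25) proves that binder UNCONDITIONALLY from
`W.kodairaSymbolAt (placeOf 3) = .IIIstar` (Tate's Step-9 normal form: every `ℚ₃`-root of `Ψ₃` has
`v₃ = 1` and `Ψ₂²` there has the odd valuation `3`). Every END-eligible (t′) row is of type `III*`
(a good-ordinary companion forces the ramified stable line; o5-r2 GEN 25 census: `354 / 354`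
rank-`1` `U0` rows are `III*`, EVIDENCE), so the END loses one opaque local binder in exchange for
the Kodaira symbol, a datum of the Cremona / LMFDB label (kernel-certifiable per row by
`kodairaSymbolOfMinimal_eq_IIIstar_of_step9`):

* `o5_index_unit_of_ordinary_companion_cited_s0g` — `_cited_s0f` with `ht3` REPLACED by
  `hK3 : W.kodairaSymbolAt (placeOf 3) = .IIIstar`; every other binder verbatim, in order
  (proof: `_cited_s0f … (noLocalThreeTorsionAt_three_of_kodairaSymbolAt_IIIstar W hK3) …`).
* `…_cited_s0g_iso` / `…_cited_s0g_x3e` / `…_cited_s0g_x3eRev` — the same END in the ISO currency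
  (`hT : TorsionIso G W 3` for `hcong`) and in the X3E certificate currencies (one direct / one
  reverse Hesse-family row `(l m u) hu h4 h6`), via part 20's
  `isCongruentModThree_of_torsionIso / _of_hesseCertificate / _of_dualHesseCertificate`
  (`O5/HeegnerLogTransportThreeIsoCurrency.lean`, in the tree).

Order of record: `_cited_s0e` (p355323) → `_cited_s0f` (p356092, `htamGd'` deleted) →
`_cited_s0f_{iso,x3e,x3eRev}` (harvest-2 E117 = o5-r2 part 22, `hcong` in kernel currencies) →
`_cited_s0g[_iso,_x3e,_x3eRev]` (this file, `ht3` discharged on `III*`). What remains displayed and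
NOT discharged here: the cited inputs, `hρ`, `hadd`, `htℓ` (`ℓ ≠ 3`; E111 transports it to the
companion), `hunitW/hunitG/htam/htamG/hordG`, the Heegner / Selmer / Manin data. O5 OPEN.

PLACEMENT (for the typer): NEW leaf over `…StepZeroEndAnyDiscr` (p356092) + part 20
`…IsoCurrency` (tree) + `O5/NoLocalThreeTorsionIIIstar.lean` (o5-r2 GEN 25, to be placed first);
no node touched; nothing else imports it.

References: as in `O5/HeegnerLogTransportThreeStepZeroEndAnyDiscr.lean` and
`O5/NoLocalThreeTorsionIIIstar.lean` [SilvermanATAEC1994, IV.9.4 Step 9]; cell: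
HOME/b2b-bsdres-o5-r2/gen25/O5-GEN25.md.

## TYPER PLACEMENT NOTE (cc-typer-5 GEN 20 = O5 §3.5 / O6 §3.4 typer of record; by-name ask A-O5-G25-1 of o5-r2 GEN 25, HOME/INBOX.md l.14643:
'(a) NEW leaf `O5/NoLocalThreeTorsionIIIstar.lean` 2a73e90dd64f5997 THEN (b) NEW leaf `O5/HeegnerLogTransportThreeStepZeroEndIIIstar.lean` 399b945a73c1b077 — by sha,
byte-identical + your ¶, or not at all'; harvest-2 GEN 60 l.14659 / l.14661: '(a) and (b) are YOURS — harvest-2 does NOT file them'; memo `HOME/b2b-bsdres-o5-r2/gen25/O5-GEN25.md`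
b7e09027186a970a; order of record (a) → (b), after this seat's A-O5-G24-1 parts 20 p356385 / 20b p356989 / 21 p357273)

Source: `HOME/b2b-bsdres-o5-r2/gen25/lean/HeegnerLogTransportThreeStepZeroEndIIIstar.lean` sha16 `399b945a73c1b077` (293 l.; `gen25/SHA16.txt`; o5-r2's check with (a) INLINED (its olean did not exist yet):
`gen25/lean/scratch/scratch_IIIstar_part23_inlined.lean` fc944d9b3b92b6c0 rc 0 / 0 warn / 0 sorry, `#print axioms …_s0g_x3eRev` standard), re-hashed by the typer right before writing;
THIS file = KL3 part 23 = the source VERBATIM + this paragraph EXCEPT ONE TYPER CITE-TAG CORRECTION (the byte-identical placement dry-ran BOUNCED `lint.tags`: cite key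
'Fisher2012' is not in `lean/references.bib` — the tree's key for T. Fisher, *The Hessian of a genus one curve*, Proc. LMS 104 (2012) is `Fisher2012Hessian`, and the
result used (via part 20 / `Fisher2012.threeCongruent_of_hesseCertificate_unconditional`) is its §13 Theorem 13.2 (`n = 3`) — the arXiv text math/0610403 of that bib
entry has no numbered 'Theorem 1.1' (typer read §1 and §13; the tree's `Fisher2012/*` files cite Thm. 13.2)): source l.188 '…Fisher 2012 Thm 1.1 in the tree' → 'Thm. 13.2 (`n = 3`)', l.190 cite tag ‹Fisher2012, Theorem 1.1› → ‹Fisher2012Hessian,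
Thm. 13.2 (n = 3)› (docstring of `…_s0g_x3e`), l.241 the same tag → ‹Fisher2012Hessian, §13 (analogue of Thm. 13.2 for X_E^-(3))› (docstring of `…_s0g_x3eRev`) —
exactly the tags parts 20 / 21 carry for the same two theorems; corrected source sha16 257eaf2787c5e577 (293 l.; `class-closure/typer-5/gen20/citefix.diff`, 3 doc lines;
every `theorem` statement and proof byte-identical to 399b945a73c1b077, every other docstring / the module text unchanged; o5-r2 may object on the bus — then this leaf
is re-cut from their v2); script `class-closure/typer-5/gen20/g25_place.py` (asserts both shas and the three source lines before rewriting them,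
docstring anchor asserted); imports harvest-2's `O5.HeegnerLogTransportThreeStepZeroEndAnyDiscr` (p356092, `_cited_s0f`), part 20 `O5.HeegnerLogTransportThreeIsoCurrency` (p356385,
this seat) and (a) `O5.NoLocalThreeTorsionIIIstar` (p358015, this seat) — all in the tree; independent of E117 (p357191) / part 20b / part 21 by name and import; the typer's own
STANDALONE farm check on the tree imports ((a)'s olean built; rc 0 / 0 warnings / 0 sorries; `#print axioms` of `…_cited_s0g` and `…_s0g_x3eRev` standard) and DEDUP (`lean search --decl`
on the 4 new names: no match) precede the proposal.
CONTENT LABELS (source, unchanged): THEOREMS ONLY (4: `o5_index_unit_of_ordinary_companion_cited_s0g` = `_cited_s0f` with `ht3 : NoLocalThreeTorsionAt W 3` REPLACED by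
`hK3 : W.kodairaSymbolAt (placeOf 3) = .IIIstar`, every other binder verbatim and in order; `…_s0g_iso` (`hT : TorsionIso G W 3` for `hcong`), `…_s0g_x3e` / `…_s0g_x3eRev` (one direct /
reverse X3E row `(l m u) hu h4 h6`)) — 0 `def`, 0 `@[conjecture]`, 0 Literature facts (net named-fact debt 0), no `sorry`; published inputs stay displayed hypotheses BY NAME
(A314 Kriz–Li Thm. 1.16 `KrizLi2019.thm116_padicLogHeegner_congruence`, Poitou–Tate, local EP, Yan–Zhu 4.15, Wuthrich L20, modularity, GZK — exactly `_cited_s0f`'s); tree theorems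
reused BY NAME (`_cited_s0f`, (a)'s `noLocalThreeTorsionAt_three_of_kodairaSymbolAt_IIIstar`, part 20's `isCongruentModThree_of_torsionIso / _of_hesseCertificate / _of_dualHesseCertificate`),
nothing re-proved. Order of record: `_cited_s0e` (p355323) → `_cited_s0f` (p356092) → `_cited_s0f_{iso,x3e,x3eRev}` (E117 p357191) → `_cited_s0g[_iso,_x3e,_x3eRev]` (this file).
HONEST FRAMING (cell `b2b-bsdres`): research route, lane CLASS-CLOSURE §3.5 O5; nothing asserted beyond the displayed binders, nothing booked, no mark /
label / count / tier of `RESIDUAL-MAP.md` moves; census numbers (the GEN 25 `U0` census: 354 / 354 END-eligible rank-1 rows are `III*`) = EVIDENCE, never a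
Literature fact; O5 OPEN.
-/

noncomputable section

open scoped Classical NumberField

open IsDedekindDomain Field WeierstrassCurve Literature.NumberTheory.EllipticCurves
  Literature.NumberTheory.EllipticCurves.ModularForms
  Literature.NumberTheory.EllipticCurves.Rank1Residual
  Literature.NumberTheory.EllipticCurves.Rank1Residual.Typed
  Literature.NumberTheory.GaloisRepresentations Rat.HeightOneSpectrum
open Literature.NumberTheory.EllipticCurves.Fisher2012 (hesseC4three hesseC6three hesseD3)
open Summit.BirchSwinnertonDyer.Rank1Residual.X1.CongruenceTransfer (TorsionIso)
open Summit.BirchSwinnertonDyer.Rank1Residual.X11b (embAt)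
open Literature.NumberTheory.GaloisCohomology (poitouTate_selmerStructure_duality)
open Summit.BirchSwinnertonDyer.Rank1Residual.Additive (placeOf)

set_option autoImplicit false

namespace Summit.BirchSwinnertonDyer.Rank1Residual.O5.HeegnerLogTransport

/-- **END `_cited_s0g` — `_cited_s0f` with `ht3` DISCHARGED on the `III*` stratum.** For an O5b
curve `W` (`Addv W 3`, Kodaira `III*` at `3`, `ρ̄_{W,3}` surjective) with a good-ORDINARY mod-3
congruent companion `G` and the displayed cited inputs / local units / Heegner–Selmer–Manin data:
`3 ∤ [W(K) : ℤ·P_K]`. `hK3 : W.kodairaSymbolAt (placeOf 3) = .IIIstar` replaces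
`ht3 : NoLocalThreeTorsionAt W 3` (`noLocalThreeTorsionAt_three_of_kodairaSymbolAt_IIIstar`); every
other binder of `_cited_s0f` verbatim. CONDITIONAL theorem; nothing booked; O5 OPEN.
[cite: KrizLi2019, Theorem 1.16] [cite: SilvermanATAEC1994, IV.9.4 Step 9 (normal form of type III*)] -/
theorem o5_index_unit_of_ordinary_companion_cited_s0g
    (hKL : KrizLi2019.thm116_padicLogHeegner_congruence)
    (hPT : ∀ (K : Type) [Field K] [NumberField K], poitouTate_selmerStructure_duality K)
    (hEP : ∀ (K : Type) [Field K] [NumberField K] (v : HeightOneSpectrum (𝓞 K)),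
      localEulerPoincareCharacteristic (v.adicCompletion K))
    (hYZ : YanZhu2026.thm415_padicValRat_bsd_rank_le_one)
    (hW20 : Wuthrich2014.lemma20_surjective_threeAdic_of_semistable)
    (hmod : exists_isNewformOf) (hGZK : rank_eq_analyticRank_of_analyticRank_le_one)
    (W G : WeierstrassCurve ℚ) [W.IsElliptic] [W.IsGloballyMinimal] [G.IsElliptic] [G.IsGloballyMinimal]
    (hcong : ∀ ℓ : ℕ, ℓ.Prime → ¬ (ℓ ∣ 3 * W.conductorNorm ℤ * G.conductorNorm ℤ) →
      ((W.LFunction ℓ : ℤ) : ZMod 3) = ((G.LFunction ℓ : ℤ) : ZMod 3))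
    (hρ : W.HasSurjectiveModNGaloisRep 3) (hadd : Addv W 3)
    (hK3 : W.kodairaSymbolAt (placeOf 3) = .IIIstar)
    (htℓ : ∀ (ℓ : ℕ) [Fact ℓ.Prime], ℓ ≠ 3 → (ℓ : ℤ) ∣ W.conductorNorm ℤ * G.conductorNorm ℤ →
      NoLocalThreeTorsionAt W ℓ)
    (hunitW : ∀ ℓ ∈ klSet W G, ℓ ≠ 3 → padicValInt 3 (nsCount W ℓ) = 0)
    (hunitG : ∀ ℓ ∈ klSet G W, ℓ ≠ 3 → padicValInt 3 (nsCount G ℓ) = 0)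
    (htam : ¬ 3 ∣ W.tamagawaProduct) (htamG : ¬ 3 ∣ G.tamagawaProduct) (hordG : GoodOrd G 3)
    (Gd : WeierstrassCurve ℚ) [Gd.IsElliptic] [Gd.IsGloballyMinimal]
    {N N' : ℕ} [NeZero N] [NeZero N'] (D : ModularParametrizationData W N)
    (D' : ModularParametrizationData G N')
    (K : Type) [Field K] [NumberField K] (hK : IsImaginaryQuadratic K)
    (hH : SatisfiesHeegnerHypothesis N K) (hH' : SatisfiesHeegnerHypothesis N' K)
    (hKoW : kolyvagin N W K) (hKoG : kolyvagin N' G K) (hGZG : gross_zagier N' G K)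
    (hd : NumberField.discr K < -4)
    (hGd : ∃ C : VariableChange ℚ, C • G.quadraticTwist (NumberField.discr K : ℚ) = Gd)
    (H : HeegnerDatum N (NumberField.discr K)) (H' : HeegnerDatum N' (NumberField.discr K))
    (ι : K →+* ℂ) (𝔭 : HeightOneSpectrum (𝓞 K)) (h𝔭 : ((3 : ℕ) : 𝓞 K) ∈ 𝔭.asIdeal)
    (he : 𝔭.asIdeal.ramificationIdx (𝓞 ℚ) = 1) (hf : 𝔭.asIdeal.inertiaDeg (𝓞 ℚ) = 1)
    (P : (W.baseChange K).toAffine.Point) (P' : (G.baseChange K).toAffine.Point)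
    (hP : WeierstrassCurve.Affine.Point.map ι.toRatAlgHom P = heegnerPointComplex D H)
    (hP' : WeierstrassCurve.Affine.Point.map ι.toRatAlgHom P' = heegnerPointComplex D' H')
    (hPinf : ¬ IsOfFinAddOrder P) (hP'inf : ¬ IsOfFinAddOrder P')
    (Wt : WeierstrassCurve ℚ) [Wt.IsElliptic]
    (hWt : ∃ C : VariableChange ℚ, C • W.quadraticTwist (NumberField.discr K : ℚ) = Wt)
    (htorst : ¬ 3 ∣ Wt.torsionOrder)
    (hSelW : Nat.card (W.selmerGroup (3 : ℤ)) = 3 ^ W.mordellWeilRank)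
    (hSelWt : Nat.card (Wt.selmerGroup (3 : ℤ)) = 3 ^ Wt.mordellWeilRank)
    (hQW : ∃ Q : (W.baseChange K).toAffine.Point, ¬ IsOfFinAddOrder Q ∧
      X11b.padicLogOrd W 3 (embAt K 3 𝔭 h𝔭 he hf) Q = 0)
    (hcD : padicValInt 3 D.maninConstant = 0) (hc3' : ¬ ((3 : ℤ) ∣ D'.maninConstant)) :
    padicValNat 3 (AddSubgroup.zmultiples P).index = 0 :=
  o5_index_unit_of_ordinary_companion_cited_s0f hKL hPT hEP hYZ hW20 hmod hGZK W G hcong hρ hadd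
    (noLocalThreeTorsionAt_three_of_kodairaSymbolAt_IIIstar W hK3) htℓ hunitW hunitG htam htamG hordG Gd D D' K hK hH hH'
    hKoW hKoG hGZG hd hGd H H' ι 𝔭 h𝔭 he hf P P' hP hP' hPinf hP'inf Wt hWt htorst hSelW hSelWt
    hQW hcD hc3'

/-- **END `_cited_s0g_iso`** — `_cited_s0g` in the ISO currency: `hT : TorsionIso G W 3`
(a `Gal(ℚ̄/ℚ)`-equivariant `G[3] ≃ W[3]`) replaces `hcong` (part 20
`isCongruentModThree_of_torsionIso`); `hK3` (Kodaira `III*` at `3`) replaces `ht3`. CONDITIONAL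
theorem; nothing booked; O5 OPEN. [cite: KrizLi2019, Theorem 1.16] -/
theorem o5_index_unit_of_ordinary_companion_cited_s0g_iso
    (hKL : KrizLi2019.thm116_padicLogHeegner_congruence)
    (hPT : ∀ (K : Type) [Field K] [NumberField K], poitouTate_selmerStructure_duality K)
    (hEP : ∀ (K : Type) [Field K] [NumberField K] (v : HeightOneSpectrum (𝓞 K)),
      localEulerPoincareCharacteristic (v.adicCompletion K))
    (hYZ : YanZhu2026.thm415_padicValRat_bsd_rank_le_one)
    (hW20 : Wuthrich2014.lemma20_surjective_threeAdic_of_semistable)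
    (hmod : exists_isNewformOf) (hGZK : rank_eq_analyticRank_of_analyticRank_le_one)
    (W G : WeierstrassCurve ℚ) [W.IsElliptic] [W.IsGloballyMinimal] [G.IsElliptic] [G.IsGloballyMinimal]
    (hT : TorsionIso G W 3)
    (hρ : W.HasSurjectiveModNGaloisRep 3) (hadd : Addv W 3)
    (hK3 : W.kodairaSymbolAt (placeOf 3) = .IIIstar)
    (htℓ : ∀ (ℓ : ℕ) [Fact ℓ.Prime], ℓ ≠ 3 → (ℓ : ℤ) ∣ W.conductorNorm ℤ * G.conductorNorm ℤ →
      NoLocalThreeTorsionAt W ℓ)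
    (hunitW : ∀ ℓ ∈ klSet W G, ℓ ≠ 3 → padicValInt 3 (nsCount W ℓ) = 0)
    (hunitG : ∀ ℓ ∈ klSet G W, ℓ ≠ 3 → padicValInt 3 (nsCount G ℓ) = 0)
    (htam : ¬ 3 ∣ W.tamagawaProduct) (htamG : ¬ 3 ∣ G.tamagawaProduct) (hordG : GoodOrd G 3)
    (Gd : WeierstrassCurve ℚ) [Gd.IsElliptic] [Gd.IsGloballyMinimal]
    {N N' : ℕ} [NeZero N] [NeZero N'] (D : ModularParametrizationData W N)
    (D' : ModularParametrizationData G N')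
    (K : Type) [Field K] [NumberField K] (hK : IsImaginaryQuadratic K)
    (hH : SatisfiesHeegnerHypothesis N K) (hH' : SatisfiesHeegnerHypothesis N' K)
    (hKoW : kolyvagin N W K) (hKoG : kolyvagin N' G K) (hGZG : gross_zagier N' G K)
    (hd : NumberField.discr K < -4)
    (hGd : ∃ C : VariableChange ℚ, C • G.quadraticTwist (NumberField.discr K : ℚ) = Gd)
    (H : HeegnerDatum N (NumberField.discr K)) (H' : HeegnerDatum N' (NumberField.discr K))
    (ι : K →+* ℂ) (𝔭 : HeightOneSpectrum (𝓞 K)) (h𝔭 : ((3 : ℕ) : 𝓞 K) ∈ 𝔭.asIdeal)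
    (he : 𝔭.asIdeal.ramificationIdx (𝓞 ℚ) = 1) (hf : 𝔭.asIdeal.inertiaDeg (𝓞 ℚ) = 1)
    (P : (W.baseChange K).toAffine.Point) (P' : (G.baseChange K).toAffine.Point)
    (hP : WeierstrassCurve.Affine.Point.map ι.toRatAlgHom P = heegnerPointComplex D H)
    (hP' : WeierstrassCurve.Affine.Point.map ι.toRatAlgHom P' = heegnerPointComplex D' H')
    (hPinf : ¬ IsOfFinAddOrder P) (hP'inf : ¬ IsOfFinAddOrder P')
    (Wt : WeierstrassCurve ℚ) [Wt.IsElliptic]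
    (hWt : ∃ C : VariableChange ℚ, C • W.quadraticTwist (NumberField.discr K : ℚ) = Wt)
    (htorst : ¬ 3 ∣ Wt.torsionOrder)
    (hSelW : Nat.card (W.selmerGroup (3 : ℤ)) = 3 ^ W.mordellWeilRank)
    (hSelWt : Nat.card (Wt.selmerGroup (3 : ℤ)) = 3 ^ Wt.mordellWeilRank)
    (hQW : ∃ Q : (W.baseChange K).toAffine.Point, ¬ IsOfFinAddOrder Q ∧
      X11b.padicLogOrd W 3 (embAt K 3 𝔭 h𝔭 he hf) Q = 0)
    (hcD : padicValInt 3 D.maninConstant = 0) (hc3' : ¬ ((3 : ℤ) ∣ D'.maninConstant)) :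
    padicValNat 3 (AddSubgroup.zmultiples P).index = 0 :=
  o5_index_unit_of_ordinary_companion_cited_s0g hKL hPT hEP hYZ hW20 hmod hGZK W G
    (isCongruentModThree_of_torsionIso W G hT) hρ hadd hK3 htℓ hunitW hunitG htam htamG hordG Gd D D' K hK hH hH'
    hKoW hKoG hGZG hd hGd H H' ι 𝔭 h𝔭 he hf P P' hP hP' hPinf hP'inf Wt hWt htorst hSelW hSelWt
    hQW hcD hc3'

/-- **END `_cited_s0g_x3e`** — `_cited_s0g` in the X3E certificate currency: one DIRECT Hesse-family
row `(l, m, u)`, `u ≠ 0`, `c₄(l,m) = u⁴c₄(G)`, `c₆(l,m) = u⁶c₆(G)` on `W`'s `(c₄, c₆)` replaces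
`hcong` (part 20 `isCongruentModThree_of_hesseCertificate`, Fisher 2012 Thm. 13.2 (`n = 3`) in the tree);
`hK3` replaces `ht3`. CONDITIONAL theorem; nothing booked; O5 OPEN.
[cite: KrizLi2019, Theorem 1.16] [cite: Fisher2012Hessian, Thm. 13.2 (n = 3)] -/
theorem o5_index_unit_of_ordinary_companion_cited_s0g_x3e
    (hKL : KrizLi2019.thm116_padicLogHeegner_congruence)
    (hPT : ∀ (K : Type) [Field K] [NumberField K], poitouTate_selmerStructure_duality K)
    (hEP : ∀ (K : Type) [Field K] [NumberField K] (v : HeightOneSpectrum (𝓞 K)),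
      localEulerPoincareCharacteristic (v.adicCompletion K))
    (hYZ : YanZhu2026.thm415_padicValRat_bsd_rank_le_one)
    (hW20 : Wuthrich2014.lemma20_surjective_threeAdic_of_semistable)
    (hmod : exists_isNewformOf) (hGZK : rank_eq_analyticRank_of_analyticRank_le_one)
    (W G : WeierstrassCurve ℚ) [W.IsElliptic] [W.IsGloballyMinimal] [G.IsElliptic] [G.IsGloballyMinimal]
    (l m u : ℚ) (hu : u ≠ 0)
    (h4 : MvPolynomial.eval ![l, m] (hesseC4three W.c₄ W.c₆) = u ^ 4 * G.c₄)
    (h6 : MvPolynomial.eval ![l, m] (hesseC6three W.c₄ W.c₆) = u ^ 6 * G.c₆)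
    (hρ : W.HasSurjectiveModNGaloisRep 3) (hadd : Addv W 3)
    (hK3 : W.kodairaSymbolAt (placeOf 3) = .IIIstar)
    (htℓ : ∀ (ℓ : ℕ) [Fact ℓ.Prime], ℓ ≠ 3 → (ℓ : ℤ) ∣ W.conductorNorm ℤ * G.conductorNorm ℤ →
      NoLocalThreeTorsionAt W ℓ)
    (hunitW : ∀ ℓ ∈ klSet W G, ℓ ≠ 3 → padicValInt 3 (nsCount W ℓ) = 0)
    (hunitG : ∀ ℓ ∈ klSet G W, ℓ ≠ 3 → padicValInt 3 (nsCount G ℓ) = 0)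
    (htam : ¬ 3 ∣ W.tamagawaProduct) (htamG : ¬ 3 ∣ G.tamagawaProduct) (hordG : GoodOrd G 3)
    (Gd : WeierstrassCurve ℚ) [Gd.IsElliptic] [Gd.IsGloballyMinimal]
    {N N' : ℕ} [NeZero N] [NeZero N'] (D : ModularParametrizationData W N)
    (D' : ModularParametrizationData G N')
    (K : Type) [Field K] [NumberField K] (hK : IsImaginaryQuadratic K)
    (hH : SatisfiesHeegnerHypothesis N K) (hH' : SatisfiesHeegnerHypothesis N' K)
    (hKoW : kolyvagin N W K) (hKoG : kolyvagin N' G K) (hGZG : gross_zagier N' G K)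
    (hd : NumberField.discr K < -4)
    (hGd : ∃ C : VariableChange ℚ, C • G.quadraticTwist (NumberField.discr K : ℚ) = Gd)
    (H : HeegnerDatum N (NumberField.discr K)) (H' : HeegnerDatum N' (NumberField.discr K))
    (ι : K →+* ℂ) (𝔭 : HeightOneSpectrum (𝓞 K)) (h𝔭 : ((3 : ℕ) : 𝓞 K) ∈ 𝔭.asIdeal)
    (he : 𝔭.asIdeal.ramificationIdx (𝓞 ℚ) = 1) (hf : 𝔭.asIdeal.inertiaDeg (𝓞 ℚ) = 1)
    (P : (W.baseChange K).toAffine.Point) (P' : (G.baseChange K).toAffine.Point)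
    (hP : WeierstrassCurve.Affine.Point.map ι.toRatAlgHom P = heegnerPointComplex D H)
    (hP' : WeierstrassCurve.Affine.Point.map ι.toRatAlgHom P' = heegnerPointComplex D' H')
    (hPinf : ¬ IsOfFinAddOrder P) (hP'inf : ¬ IsOfFinAddOrder P')
    (Wt : WeierstrassCurve ℚ) [Wt.IsElliptic]
    (hWt : ∃ C : VariableChange ℚ, C • W.quadraticTwist (NumberField.discr K : ℚ) = Wt)
    (htorst : ¬ 3 ∣ Wt.torsionOrder)
    (hSelW : Nat.card (W.selmerGroup (3 : ℤ)) = 3 ^ W.mordellWeilRank)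
    (hSelWt : Nat.card (Wt.selmerGroup (3 : ℤ)) = 3 ^ Wt.mordellWeilRank)
    (hQW : ∃ Q : (W.baseChange K).toAffine.Point, ¬ IsOfFinAddOrder Q ∧
      X11b.padicLogOrd W 3 (embAt K 3 𝔭 h𝔭 he hf) Q = 0)
    (hcD : padicValInt 3 D.maninConstant = 0) (hc3' : ¬ ((3 : ℤ) ∣ D'.maninConstant)) :
    padicValNat 3 (AddSubgroup.zmultiples P).index = 0 :=
  o5_index_unit_of_ordinary_companion_cited_s0g hKL hPT hEP hYZ hW20 hmod hGZK W G
    (isCongruentModThree_of_hesseCertificate W G l m u hu h4 h6) hρ hadd hK3 htℓ hunitW hunitG htam htamG hordG Gd D D' K hK hH hH'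
    hKoW hKoG hGZG hd hGd H H' ι 𝔭 h𝔭 he hf P P' hP hP' hPinf hP'inf Wt hWt htorst hSelW hSelWt
    hQW hcD hc3'

/-- **END `_cited_s0g_x3eRev`** — `_cited_s0g` in the reverse (dual Hesse family) X3E currency
(part 20 `isCongruentModThree_of_dualHesseCertificate`); `hK3` replaces `ht3`. CONDITIONAL theorem;
nothing booked; O5 OPEN. [cite: KrizLi2019, Theorem 1.16] [cite: Fisher2012Hessian, §13 (analogue of Thm. 13.2 for X_E^-(3))] -/
theorem o5_index_unit_of_ordinary_companion_cited_s0g_x3eRev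
    (hKL : KrizLi2019.thm116_padicLogHeegner_congruence)
    (hPT : ∀ (K : Type) [Field K] [NumberField K], poitouTate_selmerStructure_duality K)
    (hEP : ∀ (K : Type) [Field K] [NumberField K] (v : HeightOneSpectrum (𝓞 K)),
      localEulerPoincareCharacteristic (v.adicCompletion K))
    (hYZ : YanZhu2026.thm415_padicValRat_bsd_rank_le_one)
    (hW20 : Wuthrich2014.lemma20_surjective_threeAdic_of_semistable)
    (hmod : exists_isNewformOf) (hGZK : rank_eq_analyticRank_of_analyticRank_le_one)
    (W G : WeierstrassCurve ℚ) [W.IsElliptic] [W.IsGloballyMinimal] [G.IsElliptic] [G.IsGloballyMinimal]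
    (l m u : ℚ) (hu : u ≠ 0)
    (h4 : -MvPolynomial.eval ![l, m] (hesseD3 W.c₄ W.c₆) / (4 * (W.c₄ ^ 3 - W.c₆ ^ 2)) = u ^ 4 * G.c₄)
    (h6 : -MvPolynomial.eval ![l, m] (hesseC6three W.c₄ W.c₆) / (8 * (W.c₄ ^ 3 - W.c₆ ^ 2) ^ 2) =
      u ^ 6 * G.c₆)
    (hρ : W.HasSurjectiveModNGaloisRep 3) (hadd : Addv W 3)
    (hK3 : W.kodairaSymbolAt (placeOf 3) = .IIIstar)
    (htℓ : ∀ (ℓ : ℕ) [Fact ℓ.Prime], ℓ ≠ 3 → (ℓ : ℤ) ∣ W.conductorNorm ℤ * G.conductorNorm ℤ →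
      NoLocalThreeTorsionAt W ℓ)
    (hunitW : ∀ ℓ ∈ klSet W G, ℓ ≠ 3 → padicValInt 3 (nsCount W ℓ) = 0)
    (hunitG : ∀ ℓ ∈ klSet G W, ℓ ≠ 3 → padicValInt 3 (nsCount G ℓ) = 0)
    (htam : ¬ 3 ∣ W.tamagawaProduct) (htamG : ¬ 3 ∣ G.tamagawaProduct) (hordG : GoodOrd G 3)
    (Gd : WeierstrassCurve ℚ) [Gd.IsElliptic] [Gd.IsGloballyMinimal]
    {N N' : ℕ} [NeZero N] [NeZero N'] (D : ModularParametrizationData W N)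
    (D' : ModularParametrizationData G N')
    (K : Type) [Field K] [NumberField K] (hK : IsImaginaryQuadratic K)
    (hH : SatisfiesHeegnerHypothesis N K) (hH' : SatisfiesHeegnerHypothesis N' K)
    (hKoW : kolyvagin N W K) (hKoG : kolyvagin N' G K) (hGZG : gross_zagier N' G K)
    (hd : NumberField.discr K < -4)
    (hGd : ∃ C : VariableChange ℚ, C • G.quadraticTwist (NumberField.discr K : ℚ) = Gd)
    (H : HeegnerDatum N (NumberField.discr K)) (H' : HeegnerDatum N' (NumberField.discr K))
    (ι : K →+* ℂ) (𝔭 : HeightOneSpectrum (𝓞 K)) (h𝔭 : ((3 : ℕ) : 𝓞 K) ∈ 𝔭.asIdeal)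
    (he : 𝔭.asIdeal.ramificationIdx (𝓞 ℚ) = 1) (hf : 𝔭.asIdeal.inertiaDeg (𝓞 ℚ) = 1)
    (P : (W.baseChange K).toAffine.Point) (P' : (G.baseChange K).toAffine.Point)
    (hP : WeierstrassCurve.Affine.Point.map ι.toRatAlgHom P = heegnerPointComplex D H)
    (hP' : WeierstrassCurve.Affine.Point.map ι.toRatAlgHom P' = heegnerPointComplex D' H')
    (hPinf : ¬ IsOfFinAddOrder P) (hP'inf : ¬ IsOfFinAddOrder P')
    (Wt : WeierstrassCurve ℚ) [Wt.IsElliptic]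
    (hWt : ∃ C : VariableChange ℚ, C • W.quadraticTwist (NumberField.discr K : ℚ) = Wt)
    (htorst : ¬ 3 ∣ Wt.torsionOrder)
    (hSelW : Nat.card (W.selmerGroup (3 : ℤ)) = 3 ^ W.mordellWeilRank)
    (hSelWt : Nat.card (Wt.selmerGroup (3 : ℤ)) = 3 ^ Wt.mordellWeilRank)
    (hQW : ∃ Q : (W.baseChange K).toAffine.Point, ¬ IsOfFinAddOrder Q ∧
      X11b.padicLogOrd W 3 (embAt K 3 𝔭 h𝔭 he hf) Q = 0)
    (hcD : padicValInt 3 D.maninConstant = 0) (hc3' : ¬ ((3 : ℤ) ∣ D'.maninConstant)) :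
    padicValNat 3 (AddSubgroup.zmultiples P).index = 0 :=
  o5_index_unit_of_ordinary_companion_cited_s0g hKL hPT hEP hYZ hW20 hmod hGZK W G
    (isCongruentModThree_of_dualHesseCertificate W G l m u hu h4 h6) hρ hadd hK3 htℓ hunitW hunitG htam htamG hordG Gd D D' K hK hH hH'
    hKoW hKoG hGZG hd hGd H H' ι 𝔭 h𝔭 he hf P P' hP hP' hPinf hP'inf Wt hWt htorst hSelW hSelWt
    hQW hcD hc3'

end Summit.BirchSwinnertonDyer.Rank1Residual.O5.HeegnerLogTransport

end
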